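import Literature.NumberTheory.LFunctions.DirichletLTruncationPacked
import Literature.NumberTheory.LFunctions.DirichletLTruncationWeightBounds
import HarnessLib

/-!
# Packed truncation certificates — the A-part of a leaf (chord above, midpoint tangent below)

For a leaf `[n₀, n₀+L)` and an exponent `s = i/E ∈ [0, 1]`, with fixed-point enclosures `2^P n₀^{-s} ≤ c0h`,
`2^P n₁^{-s} ≤ c1h`, `c0l ≤ 2^P n₀^{-s}`, `cml ≤ 2^P m^{-s}` (`n₁ = n₀+L−1`, `m = n₀ + t_m`, `t_m = ⌊(L−1)/2⌋`), the integer
`ΔA = (c⁺·cml + σ⌊·mL − σ⌈·mR) − (c⁻·c0h − δ·m⁻)` of `LTruncationPacked.leafCell` is a lower bound for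
`2^P Σ_{t<L} v(n₀+t)(n₀+t)^{-s}`: the `+1` terms are bounded below by the tangent at `m` (`rpow_neg_ge_tangent`), the `−1` terms
above by the chord (`rpow_neg_le_chord`). [cite: Chua2005RealZeros, §2.2 ALGO 1]
-/

namespace Literature.NumberTheory.LFunctions

namespace LTruncationPacked

open Finset FeketePolyaKernel LTruncationCert LTruncation

section LeafA

variable {v : ℕ → ℤ}

/-- One `+1` term: `cml (1 − s (x − m)/m) ≤ 2^P x^{-s}` whatever the sign of the factor. [cite: Chua2005RealZeros, §2.2 ALGO 1] -/
theorem plus_term_bound {P : ℕ} {s : ℝ} (hs0 : 0 ≤ s) (hs1 : s ≤ 1) {m x : ℝ} (hm : 0 < m) (hx : 0 < x) {cml : ℝ}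
    (hcml0 : 0 ≤ cml) (hcml : cml ≤ (2 : ℝ) ^ P * m ^ (-s)) :
    cml * (1 - s * ((x - m) / m)) ≤ (2 : ℝ) ^ P * x ^ (-s) := by
  have htan := rpow_neg_ge_tangent hs0 hs1 hm hx
  have hxs : 0 < x ^ (-s) := Real.rpow_pos_of_pos hx _
  by_cases hf : 0 ≤ 1 - s * ((x - m) / m)
  · calc cml * (1 - s * ((x - m) / m)) ≤ (2 : ℝ) ^ P * m ^ (-s) * (1 - s * ((x - m) / m)) :=
          mul_le_mul_of_nonneg_right hcml hf
      _ = (2 : ℝ) ^ P * (m ^ (-s) * (1 - s * ((x - m) / m))) := by ring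
      _ ≤ (2 : ℝ) ^ P * x ^ (-s) := mul_le_mul_of_nonneg_left htan (by positivity)
  · rw [not_le] at hf
    calc cml * (1 - s * ((x - m) / m)) ≤ 0 := mul_nonpos_of_nonneg_of_nonpos hcml0 hf.le
      _ ≤ (2 : ℝ) ^ P * x ^ (-s) := by positivity

/-- One `−1` term (`L ≥ 2`, `t ≤ L − 1`): `2^P (n₀+t)^{-s} ≤ c0h − t·δ` with `δ = ⌊(c0l − c1h)/(L−1)⌋`. [cite: Chua2005RealZeros, §2.2 ALGO 1] -/
theorem minus_term_bound {P L n₀ t c0l c0h c1h : ℕ} {s : ℝ} (hs0 : 0 ≤ s) (hn₀ : 1 ≤ n₀) (hL : 2 ≤ L) (ht : t ≤ L - 1)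
    (hc0l : (c0l : ℝ) ≤ (2 : ℝ) ^ P * (n₀ : ℝ) ^ (-s)) (hc0h : (2 : ℝ) ^ P * (n₀ : ℝ) ^ (-s) ≤ c0h)
    (hc1h : (2 : ℝ) ^ P * ((n₀ + L - 1 : ℕ) : ℝ) ^ (-s) ≤ c1h) :
    (2 : ℝ) ^ P * ((n₀ + t : ℕ) : ℝ) ^ (-s) ≤ (c0h : ℝ) - t * (((c0l - c1h) / (L - 1) : ℕ) : ℝ) := by
  have hx0 : (0 : ℝ) < n₀ := by exact_mod_cast hn₀
  have h01 : (n₀ : ℝ) < ((n₀ + L - 1 : ℕ) : ℝ) := by exact_mod_cast (show n₀ < n₀ + L - 1 by omega)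
  have hxlo : (n₀ : ℝ) ≤ ((n₀ + t : ℕ) : ℝ) := by exact_mod_cast (Nat.le_add_right _ _)
  have hxhi : ((n₀ + t : ℕ) : ℝ) ≤ ((n₀ + L - 1 : ℕ) : ℝ) := by exact_mod_cast (show n₀ + t ≤ n₀ + L - 1 by omega)
  have hch := rpow_neg_le_chord hs0 hx0 h01 hxlo hxhi
  -- the chord in fixed point
  set f0 : ℝ := (n₀ : ℝ) ^ (-s)
  set f1 : ℝ := ((n₀ + L - 1 : ℕ) : ℝ) ^ (-s)
  have hfrac : (((n₀ + t : ℕ) : ℝ) - n₀) / (((n₀ + L - 1 : ℕ) : ℝ) - n₀) = (t : ℝ) / ((L - 1 : ℕ) : ℝ) := by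
    have : ((n₀ + L - 1 : ℕ) : ℝ) = (n₀ : ℝ) + ((L - 1 : ℕ) : ℝ) := by
      rw [show n₀ + L - 1 = n₀ + (L - 1) by omega]; push_cast; ring
    rw [this]; push_cast; congr 1 <;> ring
  rw [hfrac] at hch
  have hL1 : (0 : ℝ) < ((L - 1 : ℕ) : ℝ) := by exact_mod_cast (show 0 < L - 1 by omega)
  -- `δ ≤ 2^P (f0 − f1)/(L−1)`
  have hδ : (((c0l - c1h) / (L - 1) : ℕ) : ℝ) ≤ (2 : ℝ) ^ P * (f0 - f1) / ((L - 1 : ℕ) : ℝ) := by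
    calc (((c0l - c1h) / (L - 1) : ℕ) : ℝ) ≤ ((c0l - c1h : ℕ) : ℝ) / ((L - 1 : ℕ) : ℝ) := Nat.cast_div_le
      _ ≤ ((2 : ℝ) ^ P * (f0 - f1)) / ((L - 1 : ℕ) : ℝ) := by
          refine div_le_div_of_nonneg_right ?_ hL1.le
          by_cases hle : c1h ≤ c0l
          · rw [Nat.cast_sub hle]; linarith
          · rw [Nat.sub_eq_zero_of_le (by omega)]; push_cast
            have : f1 ≤ f0 := Real.rpow_le_rpow_of_nonpos hx0 (by exact_mod_cast (show n₀ ≤ n₀ + L - 1 by omega))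
              (by linarith)
            nlinarith [show (0 : ℝ) < 2 ^ P by positivity]
  have ht0 : (0 : ℝ) ≤ t := Nat.cast_nonneg _
  calc (2 : ℝ) ^ P * ((n₀ + t : ℕ) : ℝ) ^ (-s) ≤ (2 : ℝ) ^ P * (f0 + (f1 - f0) * ((t : ℝ) / ((L - 1 : ℕ) : ℝ))) :=
        mul_le_mul_of_nonneg_left hch (by positivity)
    _ = (2 : ℝ) ^ P * f0 - t * ((2 : ℝ) ^ P * (f0 - f1) / ((L - 1 : ℕ) : ℝ)) := by
        field_simp; ring
    _ ≤ (c0h : ℝ) - t * (((c0l - c1h) / (L - 1) : ℕ) : ℝ) := by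
        have := mul_le_mul_of_nonneg_left hδ ht0
        linarith

/-- Rounding up: `A/B ≤ ⌈A/B⌉ = (A + B − 1)/B` (naturals, `B > 0`). [folklore] -/
private theorem le_ceilDiv {A B : ℕ} (hB : 0 < B) : (A : ℝ) / B ≤ (((A + B - 1) / B : ℕ) : ℝ) := by
  have h := Nat.div_add_mod (A + B - 1) B
  have hlt := Nat.mod_lt (A + B - 1) hB
  have hA : A ≤ B * ((A + B - 1) / B) := by omega
  rw [div_le_iff₀ (by exact_mod_cast hB)]
  have : (A : ℝ) ≤ ((B * ((A + B - 1) / B) : ℕ) : ℝ) := by exact_mod_cast hA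
  push_cast at this; linarith

/-- Sign digits of `v` on `[n₀, n₀ + L)`: the `+1` positions. [cite: Chua2005RealZeros, §2.2 ALGO 1] -/
def sgnP (v : ℕ → ℤ) (n₀ : ℕ) (t : ℕ) : ℕ := ind (v (n₀ + t) = 1)

/-- Sign digits of `v` on `[n₀, n₀ + L)`: the `−1` positions. [cite: Chua2005RealZeros, §2.2 ALGO 1] -/
def sgnM (v : ℕ → ℤ) (n₀ : ℕ) (t : ℕ) : ℕ := ind (v (n₀ + t) = -1)

/-- The per-position lower weight of the `+1` class used by `leafCell` (real form): `cml + (t_m − t)σ⌊` left of the midpoint,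
`cml − (t − t_m)σ⌈` right of it. [cite: Chua2005RealZeros, §2.2 ALGO 1] -/
noncomputable def lowW (cml σf σc tm t : ℕ) : ℝ :=
  if t ≤ tm then (cml : ℝ) + ((tm - t : ℕ) : ℝ) * σf else (cml : ℝ) - ((t - tm : ℕ) : ℝ) * σc

/-- **A-part of a leaf, termwise.** With `s = i/E ≤ 1`, `m = n₀ + t_m`, `σ⌊ = ⌊i·cml/(E m)⌋`, `σ⌈ = ⌈i·cml/(E m)⌉`,
`δ = ⌊(c0l − c1h)/(L−1)⌋` (`0` if `L ≤ 1`): for every `t < L`,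
`sgnP_t · lowW_t − sgnM_t · (c0h − t δ) ≤ 2^P · v(n₀+t) · (n₀+t)^{-s}`. [cite: Chua2005RealZeros, §2.2 ALGO 1] -/
theorem leaf_A_term {P E L n₀ i c0l c0h c1h cml tm t : ℕ} (hv : ∀ n, v n = 0 ∨ v n = 1 ∨ v n = -1)
    (hn₀ : 1 ≤ n₀) (hE : 1 ≤ E) (hiE : i ≤ E) (htm : tm = (L - 1) / 2) (ht : t < L)
    (hc0l : (c0l : ℝ) ≤ (2 : ℝ) ^ P * (n₀ : ℝ) ^ (-((i : ℝ) / E)))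
    (hc0h : (2 : ℝ) ^ P * (n₀ : ℝ) ^ (-((i : ℝ) / E)) ≤ c0h)
    (hc1h : (2 : ℝ) ^ P * ((n₀ + L - 1 : ℕ) : ℝ) ^ (-((i : ℝ) / E)) ≤ c1h)
    (hcml : (cml : ℝ) ≤ (2 : ℝ) ^ P * ((n₀ + tm : ℕ) : ℝ) ^ (-((i : ℝ) / E))) :
    (sgnP v n₀ t : ℝ) * lowW cml ((i * cml) / (E * (n₀ + tm))) ((i * cml + E * (n₀ + tm) - 1) / (E * (n₀ + tm))) tm t -
        (sgnM v n₀ t : ℝ) * ((c0h : ℝ) - t * (((if L ≤ 1 then 0 else (c0l - c1h) / (L - 1) : ℕ) : ℕ) : ℝ)) ≤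
      (2 : ℝ) ^ P * ((v (n₀ + t) : ℝ) * ((n₀ + t : ℕ) : ℝ) ^ (-((i : ℝ) / E))) := by
  set s : ℝ := (i : ℝ) / E with hs
  have hE0 : (0 : ℝ) < E := by exact_mod_cast hE
  have hs0 : 0 ≤ s := by positivity
  have hs1 : s ≤ 1 := by rw [hs, div_le_one hE0]; exact_mod_cast hiE
  have hx : (0 : ℝ) < ((n₀ + t : ℕ) : ℝ) := by exact_mod_cast (show 0 < n₀ + t by omega)
  have hm : (0 : ℝ) < ((n₀ + tm : ℕ) : ℝ) := by exact_mod_cast (show 0 < n₀ + tm by omega)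
  have hEm : 0 < E * (n₀ + tm) := Nat.mul_pos (by omega) (by omega)
  rcases hv (n₀ + t) with h0 | h1 | h2
  · -- v = 0
    simp [sgnP, sgnM, ind, h0]
  · -- v = +1: tangent at m
    have hP1 : sgnP v n₀ t = 1 := by simp [sgnP, ind, h1]
    have hM0 : sgnM v n₀ t = 0 := by simp [sgnM, ind, h1]
    rw [hP1, hM0, h1]
    simp only [Nat.cast_one, Nat.cast_zero, Int.cast_one, one_mul, zero_mul, sub_zero]
    have hcml0 : (0 : ℝ) ≤ cml := Nat.cast_nonneg _
    have key := plus_term_bound (P := P) hs0 hs1 hm hx hcml0 hcml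
    refine le_trans ?_ key
    -- `lowW ≤ cml (1 − s (x − m)/m)` with `x − m = t − tm`
    have hsl : (((i * cml) / (E * (n₀ + tm)) : ℕ) : ℝ) ≤ s * cml / ((n₀ + tm : ℕ) : ℝ) := by
      calc (((i * cml) / (E * (n₀ + tm)) : ℕ) : ℝ) ≤ ((i * cml : ℕ) : ℝ) / ((E * (n₀ + tm) : ℕ) : ℝ) := Nat.cast_div_le
        _ = s * cml / ((n₀ + tm : ℕ) : ℝ) := by rw [hs]; push_cast; field_simp
    have hsc : s * cml / ((n₀ + tm : ℕ) : ℝ) ≤ (((i * cml + E * (n₀ + tm) - 1) / (E * (n₀ + tm)) : ℕ) : ℝ) := by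
      calc s * cml / ((n₀ + tm : ℕ) : ℝ) = ((i * cml : ℕ) : ℝ) / ((E * (n₀ + tm) : ℕ) : ℝ) := by
            rw [hs]; push_cast; field_simp
        _ ≤ _ := le_ceilDiv hEm
    have hxm : (((n₀ + t : ℕ) : ℝ) - ((n₀ + tm : ℕ) : ℝ)) / ((n₀ + tm : ℕ) : ℝ) = ((t : ℝ) - tm) / ((n₀ + tm : ℕ) : ℝ) := by
      push_cast; ring
    rw [hxm, lowW]
    split_ifs with hle
    · rw [Nat.cast_sub hle]
      have htt : (0 : ℝ) ≤ (tm : ℝ) - t := by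
        have : (t : ℝ) ≤ tm := (by exact_mod_cast hle)
        linarith
      have := mul_le_mul_of_nonneg_left hsl htt
      calc (cml : ℝ) + ((tm : ℝ) - t) * (((i * cml) / (E * (n₀ + tm)) : ℕ) : ℝ)
          ≤ (cml : ℝ) + ((tm : ℝ) - t) * (s * cml / ((n₀ + tm : ℕ) : ℝ)) := by linarith
        _ = cml * (1 - s * (((t : ℝ) - tm) / ((n₀ + tm : ℕ) : ℝ))) := by ring
    · rw [Nat.cast_sub (by omega)]
      have htt : (0 : ℝ) ≤ (t : ℝ) - tm := by
        have : (tm : ℝ) ≤ t := by exact_mod_cast (by omega : tm ≤ t)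
        linarith
      have := mul_le_mul_of_nonneg_left hsc htt
      calc (cml : ℝ) - ((t : ℝ) - tm) * (((i * cml + E * (n₀ + tm) - 1) / (E * (n₀ + tm)) : ℕ) : ℝ)
          ≤ (cml : ℝ) - ((t : ℝ) - tm) * (s * cml / ((n₀ + tm : ℕ) : ℝ)) := by linarith
        _ = cml * (1 - s * (((t : ℝ) - tm) / ((n₀ + tm : ℕ) : ℝ))) := by ring
  · -- v = −1: chord
    have hP0 : sgnP v n₀ t = 0 := by simp [sgnP, ind, h2]
    have hM1 : sgnM v n₀ t = 1 := by simp [sgnM, ind, h2]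
    rw [hP0, hM1, h2]
    by_cases hL : L ≤ 1
    · rw [if_pos hL]
      have ht0 : t = 0 := by omega
      subst ht0
      simp only [Nat.cast_one, Nat.cast_zero, Int.cast_neg, Int.cast_one, one_mul, zero_mul, zero_sub, mul_zero,
        sub_zero, add_zero]
      rw [show (2 : ℝ) ^ P * (-1 * (n₀ : ℝ) ^ (-s)) = -((2 : ℝ) ^ P * (n₀ : ℝ) ^ (-s)) by ring, neg_le_neg_iff]
      exact hc0h
    · rw [if_neg hL]
      simp only [Nat.cast_one, Nat.cast_zero, Int.cast_neg, Int.cast_one, one_mul, zero_mul, zero_sub]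
      rw [show (2 : ℝ) ^ P * (-1 * ((n₀ + t : ℕ) : ℝ) ^ (-s)) = -((2 : ℝ) ^ P * ((n₀ + t : ℕ) : ℝ) ^ (-s)) by ring,
        neg_le_neg_iff]
      exact minus_term_bound hs0 hn₀ (by omega) (by omega) hc0l hc0h hc1h

end LeafA

end LTruncationPacked

end Literature.NumberTheory.LFunctions
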